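import Mathlib.GroupTheory.QuotientGroup.Basic
import Mathlib.GroupTheory.Index
import Mathlib.GroupTheory.Coset.Card
import Mathlib.GroupTheory.Commutator.Basic
import Mathlib.Tactic.Ring
import Literature.Computability.AlgebraicComplexity.CohnUmansDihedralSubgroupTPP
import HarnessLib

/-!
# Subgroup TPP triples pass to quotients by a normal subgroup inside a member (Murthy 2026,
Lemma 2.10 = Neumann, private communication), and no member of a non-trivial subgroup TPP triple is
normal / contains `G'` / contains `Z(G)` in class 2 (Murthy 2026, Prop. 2.6 (2), Cor. 2.12)

Topic `Literature/Computability/AlgebraicComplexity` (group-theoretic matrix multiplication: subgroup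
TPP triples, the tree's `DihedralSubgroups.SubgroupTPP` of `CohnUmansDihedralSubgroupTPP.lean`;
companion of `SubgroupTPPAbelianPrimeIndex.lean`).

S. R. Murthy, *On the triple product property for subgroups of finite nilpotent groups of class 2*,
arXiv:2602.15796 (2026), verbatim (`ρ₀(G)` = the largest `|S||T||U|/|G|` over subgroup TPP triples):

> **Lemma 2.10.** [11] Let `(S, T, U)` be a subgroup TPP triple of `G` and `N` a normal subgroup of
> `G` such that `N ⊆ S`. Then the quotient `G/N` realises the subgroup TPP triple
> `(S/N, TN/N, UN/N)` of type `(|S|/|N|, |T|, |U|)`, and `ρ₀(G/N) ≥ |S||T||U|/|G|`. In particular, if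
> `(S, T, U)` is maximal for `G` then `ρ₀(G/N) ≥ ρ₀(G)`.  ([11] = P. M. Neumann, private
> communication, 2012.)
> *Proof.* […] Let `xN ∈ S/N ∩ (TU)N/N`. Then `xN = sN = tuN` for some `s ∈ S` and `tu ∈ TU` […]
> which implies that `tu ∈ sN ∩ TU ⊆ S ∩ TU = {1}`, that is, `tu = 1`, which, by the TPP for
> `(S, T, U)`, implies that `s = t = u = 1`. […]
>
> **Corollary 2.11.** Any group `G` contains a normal subgroup `N` such that `ρ₀(G/N) ≥ ρ₀(G)`.
> *Proof.* […] `N = Core_G(X)` […] the normal `G`-core of any member `X ∈ {S, T, U}` […]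
>
> **Proposition 2.6.** Let `(S, T, U)` be a non-trivial TPP triple of a group `G`, that is, one such
> that `|S||T||U| > |G|`. Then […] (2) […] In particular, if `(S, T, U)` is a subgroup TPP triple
> then `S, T, U` are all non-normal subgroups.
>
> **Corollary 2.12.** Let `G` be a nonabelian group and `(S, T, U)` a non-trivial subgroup TPP triple
> of `G`, that is, one such that `|S||T||U| > |G|`. Then (1) No member `S, T, U` contains the
> commutator subgroup `G'`. (2) No member `S, T, U` contains a normal subgroup `N` of `G` such that
> the quotient `G/N` is abelian. (3) If `G` is of nilpotency class 2 then no member `S, T, U` contains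
> the centre `Z(G)`. (4) If `G` is a `p`-group then no member `S, T, U` contains the Frattini
> subgroup `Φ(G)`.

## What is here (all proved; 0 definitions, 0 named facts)

* `Murthy2026_lemma210` — **Lemma 2.10**: for a normal `N ≤ S`, the images of `S, T, U` in `G ⧸ N`
  form a subgroup TPP triple with `|S̄|·|N| = |S|`, `|T̄| = |T|`, `|Ū| = |U|`
  (`Murthy2026.subgroupTPP_map_mk`, `…card_map_mk_mul_card`, `…card_map_mk_of_inf_eq_bot`), and
  `Murthy2026_lemma210_ratio`: `|S||T||U| · |G ⧸ N| = |S̄||T̄||Ū| · |G|` (i.e.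
  `ρ₀(G/N) ≥ |S||T||U|/|G|`); `Murthy2026_cor211` — **Cor. 2.11** with `N = Core_G(S)`
  (`Subgroup.normalCore`).
* `Murthy2026_prop26_2_subgroup` — **Prop. 2.6 (2), subgroup form**: if a member `S` is normal then
  `|S||T||U| ≤ |G|` (direct proof: `(t, u) ↦ (tu)S` is injective `T × U → G ⧸ S`, so
  `|T||U| ≤ [G : S]`; the note derives it from permutability — for subgroup triples this is also
  BCGPU 2023 Thm. 3.6 with `N(S) = G`, tree `NormalizerBarrier.lean`, stated there for the parallel
  notion `Literature.Barriers.MatrixMultiplication.SubgroupTPP`).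
* `Murthy2026_cor212_1` / `_2` / `_3` — **Cor. 2.12 (1)–(3)** in contrapositive form: a member
  containing `G'` (`commutator G ≤ S`), or containing a normal `N` with `G ⧸ N` commutative, or —
  when `G' ≤ Z(G)` (nilpotency class `≤ 2`) — containing `Z(G)`, forces `|S||T||U| ≤ |G|`; each
  because such a member is normal.  (4) (Frattini) is not formalised (Mathlib has no `G' ≤ Φ(G)` for
  `p`-groups at hand); it follows from (1) in the same way.

## References
* S. R. Murthy, arXiv:2602.15796 (2026): Lemma 2.10 and Cor. 2.11 (pp. 7–8), Prop. 2.6 (2) (p. 5),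
  Cor. 2.12 (pp. 8–9). [Murthy2026]
* J. Blasiak, H. Cohn, J. A. Grochow, K. Pratt, C. Umans, *Matrix multiplication via matrix groups*,
  ITCS 2023, Thm. 3.6 (the normaliser bound). [BlasiakCohnGrochowPrattUmans2023]
-/

namespace Literature.Computability.AlgebraicComplexity

open DihedralSubgroups

variable {G : Type*} [Group G]

namespace Murthy2026

/-- In a subgroup TPP triple two members meet trivially (`x ∈ S ∩ T ⇒ x · x⁻¹ · 1 = 1`).
[cite: Murthy2026, Lemma 2.10 (proof: "S ∩ TU = T ∩ U = {1}")] -/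
theorem inf_eq_bot₁₂ {S T U : Subgroup G} (h : SubgroupTPP S T U) : S ⊓ T = ⊥ :=
  (Subgroup.eq_bot_iff_forall _).2 fun _ hx =>
    SubgroupTPP.eq_one_of_mem₁₂ h (Subgroup.mem_inf.1 hx).1 (Subgroup.mem_inf.1 hx).2

/-- `S ∩ U = 1` for a subgroup TPP triple. [cite: Murthy2026, Lemma 2.10 (proof)] -/
theorem inf_eq_bot₁₃ {S T U : Subgroup G} (h : SubgroupTPP S T U) : S ⊓ U = ⊥ :=
  (Subgroup.eq_bot_iff_forall _).2 fun _ hx =>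
    SubgroupTPP.eq_one_of_mem₁₃ h (Subgroup.mem_inf.1 hx).1 (Subgroup.mem_inf.1 hx).2

/-- **Lemma 2.10, TPP part**: if `N ⊴ G` lies inside the member `S`, the images `S/N, TN/N, UN/N`
in `G ⧸ N` again form a subgroup TPP triple ("`tu ∈ sN ∩ TU ⊆ S ∩ TU = {1}` … by the TPP for
`(S, T, U)`, `s = t = u = 1`"). [cite: Murthy2026, Lemma 2.10] -/
theorem subgroupTPP_map_mk (N : Subgroup G) [N.Normal] {S T U : Subgroup G} (h : SubgroupTPP S T U)
    (hN : N ≤ S) :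
    SubgroupTPP (S.map (QuotientGroup.mk' N)) (T.map (QuotientGroup.mk' N))
      (U.map (QuotientGroup.mk' N)) := by
  rintro _ ⟨s, hs, rfl⟩ _ ⟨t, ht, rfl⟩ _ ⟨u, hu, rfl⟩ habc
  have hmem : s * t * u ∈ N := by
    rw [← QuotientGroup.eq_one_iff, QuotientGroup.mk_mul, QuotientGroup.mk_mul]
    simpa only [QuotientGroup.mk'_apply] using habc
  -- `s t u = s₁ ∈ S`, so `(s₁⁻¹ s) t u = 1` is a TPP word
  have hword : (s * t * u)⁻¹ * s * t * u = 1 := by group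
  obtain ⟨-, ht1, hu1⟩ :=
    h ((s * t * u)⁻¹ * s) (S.mul_mem (S.inv_mem (hN hmem)) hs) t ht u hu hword
  subst ht1
  subst hu1
  refine ⟨?_, by simp, by simp⟩
  simpa only [map_one, mul_one] using habc

/-- **Lemma 2.10, sizes, first member**: `|S/N| · |N| = |S|`. [cite: Murthy2026, Lemma 2.10
("of type (|S|/|N|, |T|, |U|)")] -/
theorem card_map_mk_mul_card [Finite G] (N : Subgroup G) [N.Normal] {S : Subgroup G} (hN : N ≤ S) :
    Nat.card (S.map (QuotientGroup.mk' N)) * Nat.card N = Nat.card S := by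
  have hidx : (S.map (QuotientGroup.mk' N)).index = S.index := by
    rw [Subgroup.index_map, QuotientGroup.ker_mk', QuotientGroup.range_mk', Subgroup.index_top,
      mul_one, sup_eq_left.2 hN]
  have h1 : Nat.card (S.map (QuotientGroup.mk' N)) * (S.map (QuotientGroup.mk' N)).index =
      Nat.card (G ⧸ N) := Subgroup.card_mul_index _
  have h2 : Nat.card S * S.index = Nat.card G := Subgroup.card_mul_index _
  have h3 : Nat.card G = Nat.card (G ⧸ N) * Nat.card N := Subgroup.card_eq_card_quotient_mul_card_subgroup N
  have hS : S.index ≠ 0 := Subgroup.index_ne_zero_of_finite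
  apply Nat.eq_of_mul_eq_mul_right (Nat.pos_of_ne_zero hS)
  calc Nat.card (S.map (QuotientGroup.mk' N)) * Nat.card N * S.index
      = Nat.card (S.map (QuotientGroup.mk' N)) * (S.map (QuotientGroup.mk' N)).index * Nat.card N := by
        rw [hidx]; ring
    _ = Nat.card G := by rw [h1, h3]
    _ = Nat.card S * S.index := h2.symm

/-- **Lemma 2.10, sizes, other members**: if `K ∩ N = 1` then `|KN/N| = |K|` (the quotient map is
injective on `K`). [cite: Murthy2026, Lemma 2.10 ("TN/N ≅ T/{1} ≅ T")] -/
theorem card_map_mk_of_inf_eq_bot (N : Subgroup G) [N.Normal] {K : Subgroup G} (hK : K ⊓ N = ⊥) :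
    Nat.card (K.map (QuotientGroup.mk' N)) = Nat.card K := by
  have hinj : Function.Injective ((QuotientGroup.mk' N).restrict K) := by
    rw [injective_iff_map_eq_one]
    intro x hx
    have hxN : (x : G) ∈ N := by
      rw [← QuotientGroup.eq_one_iff]; simpa using hx
    have : (x : G) ∈ K ⊓ N := Subgroup.mem_inf.2 ⟨x.2, hxN⟩
    rw [hK, Subgroup.mem_bot] at this
    exact Subtype.ext this
  rw [← MonoidHom.restrict_range, ← Nat.card_congr (MonoidHom.ofInjective hinj).toEquiv]

end Murthy2026

open Murthy2026

/-- **Murthy 2026, Lemma 2.10** (Neumann): for a subgroup TPP triple `(S, T, U)` of the finite group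
`G` and a normal subgroup `N ≤ S`, the images `(S/N, TN/N, UN/N)` form a subgroup TPP triple of
`G ⧸ N` of type `(|S|/|N|, |T|, |U|)`. [cite: Murthy2026, Lemma 2.10] -/
theorem Murthy2026_lemma210 [Finite G] (N : Subgroup G) [N.Normal] {S T U : Subgroup G}
    (h : SubgroupTPP S T U) (hN : N ≤ S) :
    SubgroupTPP (S.map (QuotientGroup.mk' N)) (T.map (QuotientGroup.mk' N))
        (U.map (QuotientGroup.mk' N)) ∧
      Nat.card (S.map (QuotientGroup.mk' N)) * Nat.card N = Nat.card S ∧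
      Nat.card (T.map (QuotientGroup.mk' N)) = Nat.card T ∧
      Nat.card (U.map (QuotientGroup.mk' N)) = Nat.card U := by
  refine ⟨subgroupTPP_map_mk N h hN, card_map_mk_mul_card N hN,
    card_map_mk_of_inf_eq_bot N ?_, card_map_mk_of_inf_eq_bot N ?_⟩
  · exact le_bot_iff.1 ((inf_le_inf_left T hN).trans (by rw [inf_comm, inf_eq_bot₁₂ h]))
  · exact le_bot_iff.1 ((inf_le_inf_left U hN).trans (by rw [inf_comm, inf_eq_bot₁₃ h]))

/-- **Murthy 2026, Lemma 2.10, ratio form** (`ρ₀(G/N) ≥ |S||T||U|/|G|`): with `S̄ = S/N`, `T̄ = TN/N`,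
`Ū = UN/N`, `|S||T||U| · |G ⧸ N| = |S̄||T̄||Ū| · |G|`. [cite: Murthy2026, Lemma 2.10] -/
theorem Murthy2026_lemma210_ratio [Finite G] (N : Subgroup G) [N.Normal] {S T U : Subgroup G}
    (h : SubgroupTPP S T U) (hN : N ≤ S) :
    Nat.card S * Nat.card T * Nat.card U * Nat.card (G ⧸ N) =
      Nat.card (S.map (QuotientGroup.mk' N)) * Nat.card (T.map (QuotientGroup.mk' N)) *
        Nat.card (U.map (QuotientGroup.mk' N)) * Nat.card G := by
  obtain ⟨-, hS, hT, hU⟩ := Murthy2026_lemma210 N h hN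
  rw [Subgroup.card_eq_card_quotient_mul_card_subgroup N, ← hS, hT, hU]
  ring

/-- **Murthy 2026, Corollary 2.11** (with the core of the first member): `N = Core_G(S)` is a normal
subgroup inside `S`, so Lemma 2.10 applies — `G ⧸ Core_G(S)` carries a subgroup TPP triple with
`|S||T||U| · |G ⧸ N| = |S̄||T̄||Ū| · |G|`, i.e. `ρ₀(G/N) ≥ |S||T||U|/|G|`.
[cite: Murthy2026, Corollary 2.11] -/
theorem Murthy2026_cor211 [Finite G] {S T U : Subgroup G} (h : SubgroupTPP S T U) :
    SubgroupTPP (S.map (QuotientGroup.mk' S.normalCore)) (T.map (QuotientGroup.mk' S.normalCore))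
        (U.map (QuotientGroup.mk' S.normalCore)) ∧
      Nat.card S * Nat.card T * Nat.card U * Nat.card (G ⧸ S.normalCore) =
        Nat.card (S.map (QuotientGroup.mk' S.normalCore)) *
          Nat.card (T.map (QuotientGroup.mk' S.normalCore)) *
          Nat.card (U.map (QuotientGroup.mk' S.normalCore)) * Nat.card G :=
  ⟨subgroupTPP_map_mk _ h S.normalCore_le, Murthy2026_lemma210_ratio _ h S.normalCore_le⟩

/-! ## Prop. 2.6 (2) and Cor. 2.12: normal members make the triple trivial -/

/-- **Murthy 2026, Proposition 2.6 (2), subgroup form** ("if `(S, T, U)` is a subgroup TPP triple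
then `S, T, U` are all non-normal subgroups", contrapositive): if the member `S` is normal then
`|S||T||U| ≤ |G|`.  Direct proof: `(t, u) ↦ (tu)S ∈ G ⧸ S` is injective on `T × U` — from
`(tu)⁻¹ t'u' ∈ S` and normality, `z = t⁻¹t' · u'u⁻¹ ∈ S` and `z⁻¹ (t⁻¹t') (u'u⁻¹) = 1` is a TPP word —
so `|T||U| ≤ [G : S]`. [cite: Murthy2026, Proposition 2.6 (2)]
[cite: BlasiakCohnGrochowPrattUmans2023, Thm. 3.6] -/
theorem Murthy2026_prop26_2_subgroup [Finite G] {S T U : Subgroup G} [hSn : S.Normal]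
    (h : SubgroupTPP S T U) : Nat.card S * Nat.card T * Nat.card U ≤ Nat.card G := by
  let f : T × U → G ⧸ S := fun x => ((x.1 : G) * (x.2 : G) : G)
  have hf : Function.Injective f := by
    rintro ⟨⟨t, ht⟩, ⟨u, hu⟩⟩ ⟨⟨t', ht'⟩, ⟨u', hu'⟩⟩ he
    have hmem : (t * u)⁻¹ * (t' * u') ∈ S := QuotientGroup.eq.1 he
    -- conjugate by `u`: `t⁻¹ t' u' u⁻¹ ∈ S`
    have hz : t⁻¹ * t' * (u' * u⁻¹) ∈ S := by
      have := hSn.conj_mem _ hmem u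
      simpa only [mul_inv_rev, mul_assoc, inv_mul_cancel, mul_one, mul_inv_cancel_left] using this
    have hword : (t⁻¹ * t' * (u' * u⁻¹))⁻¹ * (t⁻¹ * t') * (u' * u⁻¹) = 1 := by group
    obtain ⟨-, h2, h3⟩ := h _ (S.inv_mem hz) _ (T.mul_mem (T.inv_mem ht) ht') _
      (U.mul_mem hu' (U.inv_mem hu)) hword
    have e1 : t = t' := by
      have := congrArg (t * ·) h2
      simpa only [mul_inv_cancel_left, mul_one] using this.symm
    have e2 : u' = u := by
      have := congrArg (· * u) h3
      simpa only [inv_mul_cancel_right, one_mul] using this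
    subst e1; subst e2; rfl
  have hTU : Nat.card T * Nat.card U ≤ S.index := by
    rw [← Nat.card_prod, Subgroup.index]
    exact Nat.card_le_card_of_injective f hf
  calc Nat.card S * Nat.card T * Nat.card U = Nat.card S * (Nat.card T * Nat.card U) := by ring
    _ ≤ Nat.card S * S.index := Nat.mul_le_mul_left _ hTU
    _ = Nat.card G := S.card_mul_index

/-- A subgroup containing the commutator subgroup is normal (`g s g⁻¹ = [g, s] · s`). [folklore] -/
private theorem normal_of_commutator_le {S : Subgroup G} (hS : commutator G ≤ S) : S.Normal := by
  refine ⟨fun s hs g => ?_⟩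
  have hc : g * s * g⁻¹ * s⁻¹ ∈ S := by
    apply hS
    rw [commutator_def]
    exact Subgroup.commutator_mem_commutator (Subgroup.mem_top g) (Subgroup.mem_top s)
  simpa only [inv_mul_cancel_right] using S.mul_mem hc hs

/-- **Murthy 2026, Corollary 2.12 (1)** (contrapositive): a member containing the commutator subgroup
`G'` makes the triple trivial, `|S||T||U| ≤ |G|` (such a member is normal).
[cite: Murthy2026, Corollary 2.12 (1)] -/
theorem Murthy2026_cor212_1 [Finite G] {S T U : Subgroup G} (h : SubgroupTPP S T U)
    (hS : commutator G ≤ S) : Nat.card S * Nat.card T * Nat.card U ≤ Nat.card G := by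
  haveI := normal_of_commutator_le hS
  exact Murthy2026_prop26_2_subgroup h

/-- **Murthy 2026, Corollary 2.12 (2)** (contrapositive): a member containing a normal subgroup `N`
with `G ⧸ N` abelian makes the triple trivial. [cite: Murthy2026, Corollary 2.12 (2)] -/
theorem Murthy2026_cor212_2 [Finite G] {S T U : Subgroup G} (h : SubgroupTPP S T U) (N : Subgroup G)
    [N.Normal] (hab : ∀ a b : G ⧸ N, a * b = b * a) (hN : N ≤ S) :
    Nat.card S * Nat.card T * Nat.card U ≤ Nat.card G := by
  refine Murthy2026_cor212_1 h (le_trans ?_ hN)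
  rw [commutator_def, Subgroup.commutator_le]
  intro g _ s _
  rw [← QuotientGroup.eq_one_iff, commutatorElement_def, QuotientGroup.mk_mul, QuotientGroup.mk_mul,
    QuotientGroup.mk_mul, QuotientGroup.mk_inv, QuotientGroup.mk_inv, hab (↑g) (↑s), mul_inv_cancel_right,
    mul_inv_cancel]

/-- **Murthy 2026, Corollary 2.12 (3)** (contrapositive): in a group of nilpotency class `≤ 2`
(`G' ≤ Z(G)`) a member containing the centre makes the triple trivial.
[cite: Murthy2026, Corollary 2.12 (3)] -/
theorem Murthy2026_cor212_3 [Finite G] {S T U : Subgroup G} (h : SubgroupTPP S T U)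
    (hclass : commutator G ≤ Subgroup.center G) (hS : Subgroup.center G ≤ S) :
    Nat.card S * Nat.card T * Nat.card U ≤ Nat.card G :=
  Murthy2026_cor212_1 h (hclass.trans hS)

end Literature.Computability.AlgebraicComplexity
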